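import Literature.Analysis.FluidPDE.CompressibleEulerImplosionCentreSeriesTM
import HarnessLib

/-!
# Buckmaster–Cao-Labora–Gómez-Serrano at `γ = 5/3`: the series profile and its `x`-derivatives as functions of `ζ = c eˣ`

Companion of `…CentreSeriesTM` (the six functions `fW r m`, `fU r m` of `ζ`) and `…CentreExpansionWindow2` (the series
profile `Wser r c`, `Sser r c` of the crux `DenseExcursion`, line `sonic-cavity-renewal`). Deep in the disc
(`λ c eˣ < 1`, `λ = 73/25`), with `ζ = c eˣ`:

* `Wser r c x = fW r 0 ζ`, `(Wser r c)′ x = fW r 1 ζ`, `(Wser r c)″ x = fW r 2 ζ`, with the `HasDerivAt` statements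
  `hasDerivAt_Wser`, `hasDerivAt_deriv_Wser`;
* `Sser r c x = fU r 0 ζ / ζ`, `(Sser r c)′ x = (fU r 1 ζ − fU r 0 ζ)/ζ`, `(Sser r c)″ x = (fU r 2 ζ − 2 fU r 1 ζ + fU r 0 ζ)/ζ`,
  with `hasDerivAt_Sser`, `hasDerivAt_deriv_Sser`.

Termwise differentiation is `…OriginSeriesBall`; here only the bookkeeping of the substitution. No facts, no axioms.

[cite: BuckmasterCaolaboraGomezserrano2025, Prop. 2.5]
-/

noncomputable section

open Filter Topology

namespace Literature.Analysis.FluidPDE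

namespace BuckmasterCaolaboraGomezserrano2025

namespace OriginSeries

namespace CentreW2

set_option linter.style.longLine false
set_option linter.style.setOption false

variable {r c x : ℝ} (hr : r ∈ Set.Icc ((13890041/12500000 : ℚ) : ℝ) ((697/625 : ℚ) : ℝ)) (hc : 0 < c)

/-! ### Termwise identities -/

/-- `xSeries aW = fW r 0`. [folklore] -/
theorem xSeries_aW_eq (r c y : ℝ) : xSeries (aW r) c y = fW r 0 (c * Real.exp y) := by
  unfold xSeries fW cW
  refine tsum_congr fun j => ?_
  push_cast; ring

/-- `Σ aS_k ζᵏ = fU r 0 ζ / c`. [folklore] -/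
theorem tsum_aS_eq (hc : 0 < c) (r ζ : ℝ) : ∑' k : ℕ, aS r c k * ζ ^ k = fU r 0 ζ / c := by
  rw [eq_div_iff hc.ne']
  unfold fU cU
  rw [← tsum_mul_right]
  refine tsum_congr fun j => ?_
  rw [aS_eq_aU_div]
  field_simp
  push_cast; ring

/-- `Σ k aS_k ζᵏ = fU r 1 ζ / c`. [folklore] -/
theorem tsum_aS1_eq (hc : 0 < c) (r ζ : ℝ) : ∑' k : ℕ, (k : ℝ) * aS r c k * ζ ^ k = fU r 1 ζ / c := by
  rw [eq_div_iff hc.ne']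
  unfold fU cU
  rw [← tsum_mul_right]
  refine tsum_congr fun j => ?_
  rw [aS_eq_aU_div]
  field_simp
  push_cast; ring

/-- `Σ k² aS_k ζᵏ = fU r 2 ζ / c`. [folklore] -/
theorem tsum_aS2_eq (hc : 0 < c) (r ζ : ℝ) : ∑' k : ℕ, (k : ℝ) * ((k : ℝ) * aS r c k) * ζ ^ k = fU r 2 ζ / c := by
  rw [eq_div_iff hc.ne']
  unfold fU cU
  rw [← tsum_mul_right]
  refine tsum_congr fun j => ?_
  rw [aS_eq_aU_div]
  field_simp
  push_cast; ring

/-- `xSeries aS = fU r 0 / c`. [folklore] -/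
theorem xSeries_aS_eq (hc : 0 < c) (r y : ℝ) : xSeries (aS r c) c y = fU r 0 (c * Real.exp y) / c := by
  unfold xSeries; exact tsum_aS_eq hc r _

/-- `xSeries (k aS_k) = fU r 1 / c`. [folklore] -/
theorem xSeries_aS1_eq (hc : 0 < c) (r y : ℝ) : xSeries (fun k : ℕ => (k : ℝ) * aS r c k) c y = fU r 1 (c * Real.exp y) / c := by
  unfold xSeries; exact tsum_aS1_eq hc r _

/-- `Wser r c x = fW r 0 (c eˣ)`. [cite: BuckmasterCaolaboraGomezserrano2025, Prop. 2.5] -/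
theorem Wser_eq_fW (r c x : ℝ) : Wser r c x = fW r 0 (c * Real.exp x) := xSeries_aW_eq r c x

/-- `Sser r c x = fU r 0 ζ / ζ`. [cite: BuckmasterCaolaboraGomezserrano2025, Prop. 2.5] -/
theorem Sser_eq_fU (hc : 0 < c) (r x : ℝ) : Sser r c x = fU r 0 (c * Real.exp x) / (c * Real.exp x) := by
  have hex : Real.exp x ≠ 0 := (Real.exp_pos x).ne'
  unfold Sser
  rw [xSeries_aS_eq hc, Real.exp_neg]
  field_simp

/-- The disc condition is open in `x`. [folklore] -/
theorem isOpen_disc (c : ℝ) : IsOpen {y : ℝ | (73 / 25 : ℝ) * (c * Real.exp y) < 1} :=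
  isOpen_lt (continuous_const.mul (continuous_const.mul Real.continuous_exp)) continuous_const

variable (hx : (73 / 25 : ℝ) * (c * Real.exp x) < 1)
include hr hc hx

/-! ### `W` and its derivatives -/

/-- `HasDerivAt (Wser r c) (fW r 1 ζ) x`. [cite: BuckmasterCaolaboraGomezserrano2025, Prop. 2.5] -/
theorem hasDerivAt_Wser : HasDerivAt (Wser r c) (fW r 1 (c * Real.exp x)) x := by
  have h := hasDerivAt_xSeries (aW_bound hr) (by norm_num) hc hx
  unfold Wser
  refine h.congr_deriv ?_
  unfold fW cW
  refine tsum_congr fun j => ?_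
  push_cast; ring

/-- `(Wser r c)′ x = fW r 1 ζ`. [cite: BuckmasterCaolaboraGomezserrano2025, Prop. 2.5] -/
theorem deriv_Wser_eq : deriv (Wser r c) x = fW r 1 (c * Real.exp x) := (hasDerivAt_Wser hr hc hx).deriv

/-- `HasDerivAt (Wser r c)′ (fW r 2 ζ) x`. [cite: BuckmasterCaolaboraGomezserrano2025, Prop. 2.5] -/
theorem hasDerivAt_deriv_Wser : HasDerivAt (deriv (Wser r c)) (fW r 2 (c * Real.exp x)) x := by
  have hK' := bound_mul_index (aW_bound hr)
  have hev : xSeries (fun k : ℕ => (k : ℝ) * aW r k) c =ᶠ[𝓝 x] deriv (Wser r c) := by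
    filter_upwards [(isOpen_disc c).mem_nhds hx] with y hy
    unfold Wser
    exact (deriv_xSeries_eq (aW_bound hr) (by norm_num) hc hy).symm
  have h := hasDerivAt_xSeries hK' (by norm_num) hc hx
  refine (h.congr_of_eventuallyEq hev.symm).congr_deriv ?_
  unfold fW cW
  refine tsum_congr fun j => ?_
  push_cast; ring

/-- `(Wser r c)″ x = fW r 2 ζ`. [cite: BuckmasterCaolaboraGomezserrano2025, Prop. 2.5] -/
theorem deriv2_Wser_eq : deriv (deriv (Wser r c)) x = fW r 2 (c * Real.exp x) := (hasDerivAt_deriv_Wser hr hc hx).deriv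

/-! ### `S` and its derivatives -/

/-- `HasDerivAt (eˣ S) (fU r 1 ζ / c) x` for the series `xSeries aS = eˣ·Sser`. [folklore] -/
theorem hasDerivAt_T : HasDerivAt (xSeries (aS r c) c) (fU r 1 (c * Real.exp x) / c) x := by
  have h := hasDerivAt_xSeries (aS_bound hr hc) (by norm_num) hc hx
  exact h.congr_deriv (tsum_aS1_eq hc r _)

/-- `HasDerivAt (eˣ S)′ (fU r 2 ζ / c) x`. [folklore] -/
theorem hasDerivAt_T1 : HasDerivAt (xSeries (fun k : ℕ => (k : ℝ) * aS r c k) c) (fU r 2 (c * Real.exp x) / c) x := by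
  have hK' := bound_mul_index (aS_bound hr hc)
  have h := hasDerivAt_xSeries hK' (by norm_num) hc hx
  exact h.congr_deriv (tsum_aS2_eq hc r _)

/-- `HasDerivAt (Sser r c) ((fU r 1 ζ − fU r 0 ζ)/ζ) x`. [cite: BuckmasterCaolaboraGomezserrano2025, Prop. 2.5] -/
theorem hasDerivAt_Sser : HasDerivAt (Sser r c) ((fU r 1 (c * Real.exp x) - fU r 0 (c * Real.exp x)) / (c * Real.exp x)) x := by
  have h1 : HasDerivAt (fun y => Real.exp (-y)) (Real.exp (-x) * -1) x := (hasDerivAt_neg x).exp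
  have h := h1.mul (hasDerivAt_T hr hc hx)
  unfold Sser
  refine h.congr_deriv ?_
  rw [xSeries_aS_eq hc, Real.exp_neg]
  have hex : Real.exp x ≠ 0 := (Real.exp_pos x).ne'
  field_simp
  ring

/-- `(Sser r c)′ x = (fU r 1 ζ − fU r 0 ζ)/ζ`. [cite: BuckmasterCaolaboraGomezserrano2025, Prop. 2.5] -/
theorem deriv_Sser_eq : deriv (Sser r c) x = (fU r 1 (c * Real.exp x) - fU r 0 (c * Real.exp x)) / (c * Real.exp x) :=
  (hasDerivAt_Sser hr hc hx).deriv

/-- `HasDerivAt (Sser r c)′ ((fU r 2 ζ − 2 fU r 1 ζ + fU r 0 ζ)/ζ) x`. [cite: BuckmasterCaolaboraGomezserrano2025, Prop. 2.5] -/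
theorem hasDerivAt_deriv_Sser : HasDerivAt (deriv (Sser r c))
    ((fU r 2 (c * Real.exp x) - 2 * fU r 1 (c * Real.exp x) + fU r 0 (c * Real.exp x)) / (c * Real.exp x)) x := by
  -- near `x` the derivative is `e^{-y} (T′ y − T y)`
  have hev : (fun y => Real.exp (-y) * (xSeries (fun k : ℕ => (k : ℝ) * aS r c k) c y - xSeries (aS r c) c y)) =ᶠ[𝓝 x]
      deriv (Sser r c) := by
    filter_upwards [(isOpen_disc c).mem_nhds hx] with y hy
    rw [deriv_Sser_eq hr hc hy, xSeries_aS_eq hc, xSeries_aS1_eq hc, Real.exp_neg]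
    have hex : Real.exp y ≠ 0 := (Real.exp_pos y).ne'
    field_simp
  have h1 : HasDerivAt (fun y => Real.exp (-y)) (Real.exp (-x) * -1) x := (hasDerivAt_neg x).exp
  have h := h1.mul ((hasDerivAt_T1 hr hc hx).sub (hasDerivAt_T hr hc hx))
  refine (h.congr_of_eventuallyEq hev.symm).congr_deriv ?_
  rw [Pi.sub_apply, xSeries_aS_eq hc, xSeries_aS1_eq hc, Real.exp_neg]
  have hex : Real.exp x ≠ 0 := (Real.exp_pos x).ne'
  field_simp
  ring

/-- `(Sser r c)″ x = (fU r 2 ζ − 2 fU r 1 ζ + fU r 0 ζ)/ζ`. [cite: BuckmasterCaolaboraGomezserrano2025, Prop. 2.5] -/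
theorem deriv2_Sser_eq : deriv (deriv (Sser r c)) x =
    (fU r 2 (c * Real.exp x) - 2 * fU r 1 (c * Real.exp x) + fU r 0 (c * Real.exp x)) / (c * Real.exp x) :=
  (hasDerivAt_deriv_Sser hr hc hx).deriv

end CentreW2

end OriginSeries

end BuckmasterCaolaboraGomezserrano2025

end Literature.Analysis.FluidPDE
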